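import Literature.NumberTheory.LFunctions.RieszMeanPerron
import Mathlib.Analysis.SpecialFunctions.Arsinh
import Mathlib.Analysis.SpecialFunctions.Integrals.Basic
import Mathlib.MeasureTheory.Measure.Lebesgue.Integral
import Mathlib.Analysis.Complex.ExponentialBounds
import HarnessLib

/-!
# An exact Mellin separation of the hyperbolic condition `mn ≤ X`: the kernel

Support for the separated bilinear discrete mean value
(`HyperbolicBilinearMeanValue.lean`), which in turn is the "separation of variables at the cost
of a factor `log q`" step in Conrey–Iwaniec, *Spacing of zeros of Hecke L-functions and the class
number problem*, Acta Arith. 103 (2002), §9 p. 20 (proof of Proposition 9.1: "we relax the condition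
`mn > q⁴` by any method of separation of variables, for example by applying Lemma 9 of [DFI1]. This
separation costs us a factor `log q`"). Everything here is PROVED; no named fact.

For an integer threshold `X ≥ 1` and a positive integer `k`, `𝟙_{k ≤ X} = (X+1−k)⁺ − (X−k)⁺`, and
`(Z−k)⁺ = Z·(1 − k/Z)⁺ = (1/2π)∫ Z^{1+c+iu} k^{−c−iu} du/((c+iu)(c+1+iu))` for `c > 0` (the Perron
kernel of order one, tree `mellinInv_kernel_eq`). Hence, with
`κ_X(u) = ((X+1)^{1+c+iu} − X^{1+c+iu})/((c+iu)(c+iu+1))`,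
`𝟙_{k ≤ X} = (1/2π)∫ κ_X(u) k^{−(c+iu)} du` EXACTLY (absolutely convergent), and
`‖κ_X(u)‖ ≤ (X+1)^c/|c+iu|`, `‖κ_X(u)‖ ≤ 2(X+1)^{1+c}/(c²+u²)`, so that for `c = 1/log(X+1)` the kernel has
L¹-mass `≤ 30(1 + log X)` — the "factor `log`".

## References
* [ConreyIwaniec2002] B. Conrey, H. Iwaniec, Acta Arith. 103 (2002) 259–312, §9 p. 20.
* [MontgomeryVaughan2007] H. L. Montgomery, R. C. Vaughan, *Multiplicative Number Theory I*, §5.1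
  (Perron's formula, Riesz means (5.19)–(5.20)).
-/

noncomputable section

open Complex MeasureTheory Set Real Filter

namespace Literature.NumberTheory.LFunctions

namespace HyperbolicSeparation

/-! ### The kernel `κ_X(u) = ((X+1)^{1+w} − X^{1+w})/(w(w+1))`, `w = c + iu` -/

/-- `‖c + iu‖ = √(c² + u²)`. [folklore] -/
private theorem norm_ofReal_add_mul_I (c u : ℝ) : ‖(c : ℂ) + u * I‖ = Real.sqrt (c ^ 2 + u ^ 2) :=
  Complex.norm_add_mul_I c u

/-- `c + iu ≠ 0` and `c + iu + 1 ≠ 0` for `c > 0`. [folklore] -/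
private theorem w_ne_zero {c : ℝ} (hc : 0 < c) (u : ℝ) :
    (c : ℂ) + u * I ≠ 0 ∧ (c : ℂ) + u * I + 1 ≠ 0 := by
  constructor
  · intro h
    have := congrArg Complex.re h
    simp at this
    linarith
  · intro h
    have := congrArg Complex.re h
    simp at this
    linarith

/-- **The numerator**: `‖(X+1)^{1+w} − X^{1+w}‖ ≤ ‖1 + w‖·(X+1)^c` for `X ≥ 1`, `w = c + iu`, `c > 0`
(`(X+1)^{1+w} − X^{1+w} = (1+w)∫_X^{X+1} y^w dy` and `|y^w| = y^c ≤ (X+1)^c`).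
[cite: ConreyIwaniec2002, §9 p. 20 (separation of variables in mn > q⁴)] -/
theorem norm_cpow_succ_sub_cpow_le {X c : ℝ} (hX : 1 ≤ X) (hc : 0 < c) (u : ℝ) :
    ‖((X + 1 : ℝ) : ℂ) ^ (1 + ((c : ℂ) + u * I)) - ((X : ℝ) : ℂ) ^ (1 + ((c : ℂ) + u * I))‖ ≤
      ‖1 + ((c : ℂ) + u * I)‖ * (X + 1) ^ c := by
  set w : ℂ := (c : ℂ) + u * I with hw
  have hw1 : w + 1 ≠ 0 := (w_ne_zero hc u).2
  have hwm1 : w ≠ -1 := fun h => hw1 (by rw [h]; ring)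
  have h0 : (0 : ℝ) ∉ Set.uIcc X (X + 1) := by
    rw [Set.uIcc_of_le (by linarith)]
    intro h
    exact absurd h.1 (by linarith)
  have hint := integral_cpow (a := X) (b := X + 1) (r := w) (Or.inr ⟨hwm1, h0⟩)
  have heq : ((X + 1 : ℝ) : ℂ) ^ (1 + w) - ((X : ℝ) : ℂ) ^ (1 + w) =
      (1 + w) * ∫ x : ℝ in X..(X + 1), (x : ℂ) ^ w := by
    rw [hint, add_comm 1 w]
    have h1w : w + 1 ≠ 0 := hw1
    field_simp
  rw [heq, norm_mul]
  refine mul_le_mul_of_nonneg_left ?_ (norm_nonneg _)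
  have hb := intervalIntegral.norm_integral_le_of_norm_le_const (a := X) (b := X + 1)
    (C := (X + 1) ^ c) (f := fun x : ℝ => (x : ℂ) ^ w) ?_
  · simpa using hb
  · intro x hx
    rw [Set.uIoc_of_le (by linarith)] at hx
    have hx0 : 0 < x := by linarith [hx.1]
    rw [Complex.norm_cpow_eq_rpow_re_of_pos hx0]
    have hre : w.re = c := by simp [hw]
    rw [hre]
    exact Real.rpow_le_rpow hx0.le hx.2 hc.le

/-- **Kernel bound near the origin**: `‖κ_X(u)‖ ≤ (X+1)^c/√(c² + u²)`.
[cite: ConreyIwaniec2002, §9 p. 20 (separation of variables in mn > q⁴)] -/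
theorem norm_kernel_le_inv_sqrt {X c : ℝ} (hX : 1 ≤ X) (hc : 0 < c) (u : ℝ) :
    ‖(((X + 1 : ℝ) : ℂ) ^ (1 + ((c : ℂ) + u * I)) - ((X : ℝ) : ℂ) ^ (1 + ((c : ℂ) + u * I))) /
        (((c : ℂ) + u * I) * ((c : ℂ) + u * I + 1))‖ ≤
      (X + 1) ^ c / Real.sqrt (c ^ 2 + u ^ 2) := by
  obtain ⟨hw0, hw1⟩ := w_ne_zero hc u
  have hn0 : 0 < ‖(c : ℂ) + u * I‖ := norm_pos_iff.mpr hw0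
  have hn1 : 0 < ‖(c : ℂ) + u * I + 1‖ := norm_pos_iff.mpr hw1
  rw [norm_div, norm_mul, ← norm_ofReal_add_mul_I, div_le_div_iff₀ (mul_pos hn0 hn1) hn0]
  calc ‖((X + 1 : ℝ) : ℂ) ^ (1 + ((c : ℂ) + u * I)) - ((X : ℝ) : ℂ) ^ (1 + ((c : ℂ) + u * I))‖ *
        ‖(c : ℂ) + u * I‖
      ≤ ‖1 + ((c : ℂ) + u * I)‖ * (X + 1) ^ c * ‖(c : ℂ) + u * I‖ :=
        mul_le_mul_of_nonneg_right (norm_cpow_succ_sub_cpow_le hX hc u) (norm_nonneg _)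
    _ = (X + 1) ^ c * (‖(c : ℂ) + u * I‖ * ‖(c : ℂ) + u * I + 1‖) := by
        rw [add_comm (1 : ℂ) ((c : ℂ) + u * I)]; ring

/-- **Kernel bound at infinity**: `‖κ_X(u)‖ ≤ 2(X+1)^{1+c}/(c² + u²)`.
[cite: ConreyIwaniec2002, §9 p. 20 (separation of variables in mn > q⁴)] -/
theorem norm_kernel_le_inv_sq {X c : ℝ} (hX : 1 ≤ X) (hc : 0 < c) (u : ℝ) :
    ‖(((X + 1 : ℝ) : ℂ) ^ (1 + ((c : ℂ) + u * I)) - ((X : ℝ) : ℂ) ^ (1 + ((c : ℂ) + u * I))) /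
        (((c : ℂ) + u * I) * ((c : ℂ) + u * I + 1))‖ ≤
      2 * (X + 1) ^ (1 + c) / (c ^ 2 + u ^ 2) := by
  have hden := sq_add_sq_le_norm_kernelDen hc.le u
  have hpos : 0 < c ^ 2 + u ^ 2 := by positivity
  rw [norm_div]
  have hnum : ‖((X + 1 : ℝ) : ℂ) ^ (1 + ((c : ℂ) + u * I)) - ((X : ℝ) : ℂ) ^ (1 + ((c : ℂ) + u * I))‖ ≤
      2 * (X + 1) ^ (1 + c) := by
    have hX1 : 0 < X + 1 := by linarith
    have hX0 : 0 < X := by linarith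
    have hre : (1 + ((c : ℂ) + u * I)).re = 1 + c := by simp
    have h1 : ‖((X + 1 : ℝ) : ℂ) ^ (1 + ((c : ℂ) + u * I))‖ = (X + 1) ^ (1 + c) := by
      rw [Complex.norm_cpow_eq_rpow_re_of_pos hX1, hre]
    have h2 : ‖((X : ℝ) : ℂ) ^ (1 + ((c : ℂ) + u * I))‖ ≤ (X + 1) ^ (1 + c) := by
      rw [Complex.norm_cpow_eq_rpow_re_of_pos hX0, hre]
      exact Real.rpow_le_rpow hX0.le (by linarith) (by linarith)
    calc _ ≤ ‖((X + 1 : ℝ) : ℂ) ^ (1 + ((c : ℂ) + u * I))‖ + ‖((X : ℝ) : ℂ) ^ (1 + ((c : ℂ) + u * I))‖ :=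
          norm_sub_le _ _
      _ ≤ (X + 1) ^ (1 + c) + (X + 1) ^ (1 + c) := by rw [h1]; exact add_le_add le_rfl h2
      _ = 2 * (X + 1) ^ (1 + c) := by ring
  calc _ ≤ 2 * (X + 1) ^ (1 + c) / ‖((c : ℂ) + u * I) * ((c : ℂ) + u * I + 1)‖ :=
        div_le_div_of_nonneg_right hnum (norm_nonneg _)
    _ ≤ 2 * (X + 1) ^ (1 + c) / (c ^ 2 + u ^ 2) := by
        apply div_le_div_of_nonneg_left _ hpos hden
        have : 0 < X + 1 := by linarith
        positivity

/-- The kernel `κ_X` is a continuous function of `u`.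
[cite: ConreyIwaniec2002, §9 p. 20 (separation of variables in mn > q⁴)] -/
theorem continuous_kernel {X c : ℝ} (hX : 1 ≤ X) (hc : 0 < c) :
    Continuous fun u : ℝ =>
      (((X + 1 : ℝ) : ℂ) ^ (1 + ((c : ℂ) + u * I)) - ((X : ℝ) : ℂ) ^ (1 + ((c : ℂ) + u * I))) /
        (((c : ℂ) + u * I) * ((c : ℂ) + u * I + 1)) := by
  have hw : Continuous fun u : ℝ => (c : ℂ) + u * I := by fun_prop
  have hX1 : ((X + 1 : ℝ) : ℂ) ≠ 0 := by exact_mod_cast (by linarith : (X + 1 : ℝ) ≠ 0)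
  have hX0 : ((X : ℝ) : ℂ) ≠ 0 := by exact_mod_cast (by linarith : (X : ℝ) ≠ 0)
  refine Continuous.div ?_ (by fun_prop) fun u => kernelDen_ne_zero hc u
  exact ((continuous_const.add hw).const_cpow (Or.inl hX1)).sub
    ((continuous_const.add hw).const_cpow (Or.inl hX0))

/-- The kernel `κ_X` is integrable on `ℝ` (it is `O((X+1)^{1+c}/(c² + u²))`).
[cite: ConreyIwaniec2002, §9 p. 20 (separation of variables in mn > q⁴)] -/
theorem integrable_kernel {X c : ℝ} (hX : 1 ≤ X) (hc : 0 < c) :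
    Integrable fun u : ℝ =>
      (((X + 1 : ℝ) : ℂ) ^ (1 + ((c : ℂ) + u * I)) - ((X : ℝ) : ℂ) ^ (1 + ((c : ℂ) + u * I))) /
        (((c : ℂ) + u * I) * ((c : ℂ) + u * I + 1)) := by
  refine ((integrable_inv_sq_add_sq hc).const_mul (2 * (X + 1) ^ (1 + c))).mono'
    (continuous_kernel hX hc).aestronglyMeasurable (Eventually.of_forall fun u => ?_)
  rw [← div_eq_mul_one_div]
  exact norm_kernel_le_inv_sq hX hc u

/-- `∫_{−Z}^{Z} du/√(c² + u²) = 2·arsinh(Z/c)`. [folklore] -/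
private theorem integral_inv_sqrt_sq_add_sq {c : ℝ} (hc : 0 < c) (Z : ℝ) :
    ∫ u in (-Z)..Z, (Real.sqrt (c ^ 2 + u ^ 2))⁻¹ = 2 * Real.arsinh (Z / c) := by
  have hderiv : ∀ u : ℝ, HasDerivAt (fun u : ℝ => Real.arsinh (u / c))
      (Real.sqrt (c ^ 2 + u ^ 2))⁻¹ u := by
    intro u
    have h1 : HasDerivAt (fun u : ℝ => u / c) (1 / c) u := by
      simpa using (hasDerivAt_id u).div_const c
    have h2 := (Real.hasDerivAt_arsinh (u / c)).comp u h1
    have heq : (Real.sqrt (1 + (u / c) ^ 2))⁻¹ * (1 / c) = (Real.sqrt (c ^ 2 + u ^ 2))⁻¹ := by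
      have hc2 : Real.sqrt (c ^ 2) = c := Real.sqrt_sq hc.le
      have : Real.sqrt (c ^ 2 + u ^ 2) = c * Real.sqrt (1 + (u / c) ^ 2) := by
        rw [← hc2, ← Real.sqrt_mul (sq_nonneg c), hc2]
        congr 1
        field_simp
      rw [this, mul_inv, mul_comm, one_div]
    rw [heq] at h2
    exact h2
  have hcont : Continuous fun u : ℝ => (Real.sqrt (c ^ 2 + u ^ 2))⁻¹ := by
    refine Continuous.inv₀ (by fun_prop) fun u => ?_
    exact (Real.sqrt_pos.mpr (by positivity)).ne'
  rw [intervalIntegral.integral_eq_sub_of_hasDerivAt (fun u _ => hderiv u)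
    (hcont.intervalIntegrable _ _)]
  rw [neg_div, Real.arsinh_neg]
  ring

/-- `arsinh(Z log Z) ≤ 1 + 2 log Z` for `Z ≥ 3`. [folklore] -/
private theorem arsinh_mul_log_le {Z : ℝ} (hZ : 3 ≤ Z) :
    Real.arsinh (Z * Real.log Z) ≤ 1 + 2 * Real.log Z := by
  have hlogZ : 1 ≤ Real.log Z := by
    rw [Real.le_log_iff_exp_le (by linarith)]
    exact Real.exp_one_lt_d9.le.trans (by linarith)
  set x : ℝ := Z * Real.log Z with hx
  have hx1 : 1 ≤ x := by rw [hx]; nlinarith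
  have hx0 : 0 < x := by linarith
  -- `arsinh x = log(x + √(1+x²)) ≤ log(3x)`
  have hsq : Real.sqrt (1 + x ^ 2) ≤ 2 * x := by
    rw [Real.sqrt_le_left (by linarith)]
    nlinarith
  have h1 : Real.arsinh x ≤ Real.log (3 * x) := by
    unfold Real.arsinh
    exact Real.log_le_log (by positivity) (by linarith)
  -- `log(3 Z log Z) = log 3 + log Z + log log Z ≤ 1.1 + log Z + (log Z − 1)`
  have h3 : Real.log 3 ≤ 6 / 5 := by
    rw [Real.log_le_iff_le_exp (by norm_num)]
    have h15 : (1 : ℝ) + 1 / 5 ≤ Real.exp (1 / 5) := by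
      have := Real.add_one_le_exp (1 / 5 : ℝ); linarith
    have hsplit : Real.exp (6 / 5 : ℝ) = Real.exp 1 * Real.exp (1 / 5) := by
      rw [← Real.exp_add]; norm_num
    rw [hsplit]
    nlinarith [Real.exp_one_gt_d9, Real.exp_pos (1 / 5 : ℝ)]
  have hll : Real.log (Real.log Z) ≤ Real.log Z - 1 := by
    have := Real.add_one_le_exp (Real.log (Real.log Z))
    rw [Real.exp_log (by linarith)] at this
    linarith
  have h2 : Real.log (3 * x) = Real.log 3 + Real.log Z + Real.log (Real.log Z) := by
    rw [hx, Real.log_mul (by norm_num) (by positivity), Real.log_mul (by linarith) (by linarith)]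
    ring
  linarith

/-- **The kernel has L¹-mass `O(log X)`**: for `X ≥ 2` and `c = 1/log(X+1)`,
`∫ ‖κ_X(u)‖ du ≤ 30(1 + log X)` ("this separation costs us a factor `log q`").
[cite: ConreyIwaniec2002, §9 p. 20] -/
theorem integral_norm_kernel_le {X : ℝ} (hX : 2 ≤ X) :
    ∫ u : ℝ, ‖(((X + 1 : ℝ) : ℂ) ^ (1 + (((1 / Real.log (X + 1) : ℝ) : ℂ) + u * I)) -
        ((X : ℝ) : ℂ) ^ (1 + (((1 / Real.log (X + 1) : ℝ) : ℂ) + u * I))) /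
        ((((1 / Real.log (X + 1) : ℝ) : ℂ) + u * I) * ((((1 / Real.log (X + 1) : ℝ) : ℂ) + u * I) + 1))‖ ≤
      30 * (1 + Real.log X) := by
  set Z : ℝ := X + 1 with hZ
  have hZ3 : 3 ≤ Z := by rw [hZ]; linarith
  have hZ0 : 0 < Z := by linarith
  have hlogZ : 1 ≤ Real.log Z := by
    rw [Real.le_log_iff_exp_le hZ0]
    exact Real.exp_one_lt_d9.le.trans (by linarith)
  set c : ℝ := 1 / Real.log (X + 1) with hc
  have hc0 : 0 < c := by rw [hc]; positivity
  have hX1 : 1 ≤ X := by linarith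
  -- `Z^c = e`, `Z^{1+c} = eZ`
  have hZc : Z ^ c = Real.exp 1 := by
    rw [Real.rpow_def_of_pos hZ0, hc, hZ]
    congr 1
    have hne : Real.log (X + 1) ≠ 0 := by rw [← hZ]; linarith
    field_simp
  have hZ1c : Z ^ (1 + c) = Z * Real.exp 1 := by
    rw [Real.rpow_add hZ0, Real.rpow_one, hZc]
  have he : Real.exp 1 ≤ 2.72 := by linarith [Real.exp_one_lt_d9]
  -- the integrand and its two majorants
  set f : ℝ → ℝ := fun u => ‖(((X + 1 : ℝ) : ℂ) ^ (1 + ((c : ℂ) + u * I)) -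
        ((X : ℝ) : ℂ) ^ (1 + ((c : ℂ) + u * I))) /
        (((c : ℂ) + u * I) * (((c : ℂ) + u * I) + 1))‖ with hf
  have hfi : Integrable f := (integrable_kernel hX1 hc0).norm
  have hfc : Continuous f := (continuous_kernel hX1 hc0).norm
  have hf0 : ∀ u, 0 ≤ f u := fun u => norm_nonneg _
  have hfA : ∀ u, f u ≤ Real.exp 1 * (Real.sqrt (c ^ 2 + u ^ 2))⁻¹ := by
    intro u
    have h := norm_kernel_le_inv_sqrt hX1 hc0 u
    rw [← hZ, hZc, div_eq_mul_inv] at h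
    exact h
  have hfB : ∀ u, Z < u → f u ≤ (2 * Real.exp 1 * Z) * u ^ (-2 : ℝ) := by
    intro u hu
    have hu0 : 0 < u := by linarith
    have h := norm_kernel_le_inv_sq hX1 hc0 u
    rw [← hZ, hZ1c] at h
    refine h.trans ?_
    rw [Real.rpow_neg hu0.le, show (2 : ℝ) = ((2 : ℕ) : ℝ) by norm_num, Real.rpow_natCast]
    rw [div_eq_mul_inv]
    have h1 : (c ^ 2 + u ^ 2)⁻¹ ≤ (u ^ 2)⁻¹ :=
      inv_anti₀ (by positivity) (by nlinarith)
    calc 2 * (Z * Real.exp 1) * (c ^ 2 + u ^ 2)⁻¹ ≤ 2 * (Z * Real.exp 1) * (u ^ 2)⁻¹ := by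
          gcongr
      _ = 2 * Real.exp 1 * Z * (u ^ 2)⁻¹ := by ring
  -- the tails: `∫_{Ioi Z} f ≤ 2e` and `∫_{Iic (-Z)} f ≤ 2e`
  have hpow : IntegrableOn (fun u : ℝ => (2 * Real.exp 1 * Z) * u ^ (-2 : ℝ)) (Ioi Z) :=
    ((integrableOn_Ioi_rpow_of_lt (by norm_num) hZ0).const_mul _)
  have hpow_val : ∫ u in Ioi Z, (2 * Real.exp 1 * Z) * u ^ (-2 : ℝ) = 2 * Real.exp 1 := by
    rw [integral_const_mul, integral_Ioi_rpow_of_lt (by norm_num) hZ0]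
    have : Z ^ ((-2 : ℝ) + 1) = Z⁻¹ := by
      rw [show (-2 : ℝ) + 1 = -1 by norm_num, Real.rpow_neg_one]
    rw [this]
    field_simp
    ring
  have htail1 : ∫ u in Ioi Z, f u ≤ 2 * Real.exp 1 := by
    rw [← hpow_val]
    exact setIntegral_mono_on hfi.integrableOn hpow measurableSet_Ioi fun u hu => hfB u hu
  have htail2 : ∫ u in Iic (-Z), f u ≤ 2 * Real.exp 1 := by
    rw [← integral_comp_neg_Ioi, ← hpow_val]
    have hfi' : Integrable fun u : ℝ => f (-u) := hfi.comp_neg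
    refine setIntegral_mono_on hfi'.integrableOn hpow measurableSet_Ioi fun u hu => ?_
    have h := hfB u hu
    -- `f (-u) ≤ e/… ` via the same bound: the majorant `2(X+1)^{1+c}/(c²+u²)` is even in `u`
    have hu0 : 0 < u := by linarith [mem_Ioi.mp hu]
    have h' := norm_kernel_le_inv_sq hX1 hc0 (-u)
    rw [← hZ, hZ1c] at h'
    refine h'.trans ?_
    rw [Real.rpow_neg hu0.le, show (2 : ℝ) = ((2 : ℕ) : ℝ) by norm_num, Real.rpow_natCast,
      div_eq_mul_inv]
    have h1 : (c ^ 2 + (-u) ^ 2)⁻¹ ≤ (u ^ 2)⁻¹ :=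
      inv_anti₀ (by positivity) (by nlinarith)
    push_cast
    calc 2 * (Z * Real.exp 1) * (c ^ 2 + (-u) ^ 2)⁻¹ ≤ 2 * (Z * Real.exp 1) * (u ^ 2)⁻¹ := by
          gcongr
      _ = 2 * Real.exp 1 * Z * (u ^ 2)⁻¹ := by ring
  -- the middle: `∫_{-Z}^{Z} f ≤ 2e·arsinh(Z/c) ≤ 2e(1 + 2 log Z)`
  have hmid : ∫ u in (-Z)..Z, f u ≤ 2 * Real.exp 1 * (1 + 2 * Real.log Z) := by
    have hcont : Continuous fun u : ℝ => Real.exp 1 * (Real.sqrt (c ^ 2 + u ^ 2))⁻¹ := by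
      refine continuous_const.mul (Continuous.inv₀ (by fun_prop) fun u => ?_)
      exact (Real.sqrt_pos.mpr (by positivity)).ne'
    have h1 : ∫ u in (-Z)..Z, f u ≤ ∫ u in (-Z)..Z, Real.exp 1 * (Real.sqrt (c ^ 2 + u ^ 2))⁻¹ :=
      intervalIntegral.integral_mono_on (by linarith) (hfc.intervalIntegrable _ _)
        (hcont.intervalIntegrable _ _) fun u _ => hfA u
    have h2 : ∫ u in (-Z)..Z, Real.exp 1 * (Real.sqrt (c ^ 2 + u ^ 2))⁻¹ =
        Real.exp 1 * (2 * Real.arsinh (Z / c)) := by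
      rw [intervalIntegral.integral_const_mul, integral_inv_sqrt_sq_add_sq hc0 Z]
    have h3 : Real.arsinh (Z / c) ≤ 1 + 2 * Real.log Z := by
      have : Z / c = Z * Real.log Z := by rw [hc, hZ]; field_simp
      rw [this]
      exact arsinh_mul_log_le hZ3
    have he0 : 0 ≤ Real.exp 1 := (Real.exp_pos 1).le
    calc ∫ u in (-Z)..Z, f u ≤ Real.exp 1 * (2 * Real.arsinh (Z / c)) := by rw [← h2]; exact h1
      _ ≤ Real.exp 1 * (2 * (1 + 2 * Real.log Z)) := by gcongr
      _ = 2 * Real.exp 1 * (1 + 2 * Real.log Z) := by ring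
  -- glue the pieces
  have hsplit : ∫ u, f u = (∫ u in Iic (-Z), f u) + (∫ u in (-Z)..Z, f u) + ∫ u in Ioi Z, f u := by
    rw [← intervalIntegral.integral_Iic_add_Ioi (b := Z) hfi.integrableOn hfi.integrableOn,
      ← intervalIntegral.integral_Iic_sub_Iic (a := -Z) (b := Z) hfi.integrableOn hfi.integrableOn]
    ring
  have hlogZX : Real.log Z ≤ 1 + Real.log X := by
    rw [hZ]
    have h2X : X + 1 ≤ 2 * X := by linarith
    calc Real.log (X + 1) ≤ Real.log (2 * X) := Real.log_le_log (by linarith) h2X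
      _ = Real.log 2 + Real.log X := Real.log_mul (by norm_num) (by linarith)
      _ ≤ 1 + Real.log X := by linarith [Real.log_two_lt_d9]
  have hlogX0 : 0 ≤ Real.log X := Real.log_nonneg (by linarith)
  show ∫ u, f u ≤ 30 * (1 + Real.log X)
  rw [hsplit]
  calc (∫ u in Iic (-Z), f u) + (∫ u in (-Z)..Z, f u) + ∫ u in Ioi Z, f u
      ≤ 2 * Real.exp 1 + 2 * Real.exp 1 * (1 + 2 * Real.log Z) + 2 * Real.exp 1 := by
        linarith [htail1, htail2, hmid]
    _ ≤ 30 * (1 + Real.log X) := by nlinarith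

end HyperbolicSeparation

end Literature.NumberTheory.LFunctions

end
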